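import Literature.NumberTheory.Automorphic.LanglandsTunnellModThree
import Literature.NumberTheory.Automorphic.TunnellOctahedralGlobal
import Literature.NumberTheory.Automorphic.TunnellLemma
import Literature.NumberTheory.Automorphic.StrongArtinGL2WeightOneDictionary
import Literature.NumberTheory.Automorphic.BaseChangeArchimedean
import Literature.NumberTheory.Automorphic.BCDTModularity
import Literature.NumberTheory.GaloisRepresentations.FramedRepTwist
import Literature.NumberTheory.GaloisRepresentations.CliffordTwistOfRestriction
import Literature.NumberTheory.EllipticCurves.NewformGaloisRep
import HarnessLib

/-!
# stub-ideation k2 · generation 18 · `stub_modThree` — companion sketch (PLAN D: GALOIS-SIDE PIN)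

Nothing registered.  Typed statements of the helper lemmas of `STUB-IDEAS-stub_modThree-2.md`
(g18, PLAN D) and the end-assembly `isModular_surj_of_planD` for the surjective (octahedral) cell,
PROVED from the typed helpers (pure composition).

PLAN D (RESHAPE: change of order + weaken-and-bootstrap).  In Tunnell's octahedral step the cubic
field `K` and the "no element of order 6" local lemma serve to pin the quadratic descent `π₀` of
`Π_E = π(σ_E)` (`E = ℚ(√-3)`, cut out by `det σ̄ = χ₃`) EXACTLY to `π(σ)` or `π(σ ⊗ ω_E)`.  For the
mod-3 target `ρ.IsModular` only ONE BIT of that pin is needed: the PARITY `ω_{π₀} = det σ` (odd);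
the rest of the pin is done on the GALOIS side AFTER Deligne–Serre: `ρ_f|_{Γ_E} ≃ σ_E`
(Chebotarev over `E` + Brauer–Nesbitt, both proved in the tree) and Clifford theory for the index-2
subgroup `Γ_E` give `ρ_f ≃ σ ⊗ χ`, `χ ∈ {1, det σ}`, and the quadratic twist by `det σ = ω_{ℚ(√-3)}`
is ABSORBED by the choice of the prime of `ℤ̄` above `3`: `Ψ ⊗ det ≡ id (mod 𝔭̄)`, `𝔭̄ = (1 - √-2)`,
just as `Ψ ≡ id (mod 𝔭)`, `𝔭 = (1 + √-2)` (`ModPGaloisRep.IsModular` quantifies `∃ ι`).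
-/

set_option linter.dupNamespace false

noncomputable section

namespace Summit.ABC.ABC.Cruxes.FreyModularity.StubModThreeIdeasK2G18

open Literature Literature.NumberTheory Literature.NumberTheory.Automorphic
open Literature.NumberTheory.GaloisRepresentations
open Literature.NumberTheory.GaloisRepresentations.GL2F3Lift
open IsDedekindDomain Polynomial Field
open scoped MatrixGroups NumberField Polynomial Classical ModularForm
open CongruenceSubgroup EllipticCurves.ModularForms Rat.HeightOneSpectrum

/-- The registered stub `stub_modThree`, verbatim (Lines/Sketch.lean l.143). -/
def SigStubModThree : Prop :=
  ∀ (W : WeierstrassCurve ℚ) [W.IsElliptic] (ρ : ModPGaloisRep ℚ (ZMod 3) 2),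
    W.IsTorsionGaloisRep 3 ρ → FramedRep.IsAbsolutelyIrreducible ρ → ρ.IsModular

/-! ### D-P — the octahedral residue: PARITY of the quadratic descent -/

/-- **D-P (parity of the descent).**  `σ` octahedral over `ℚ`, `E/ℚ` the quadratic field with
`σ̄(Γ_E) = A₄`, `Π_E = π(σ_E)` exact, `π₀` a cuspidal weak descent of `Π_E` to `ℚ`.  Then the central
character of `π₀` is `det σ`: `∏ t_{π₀,v} = det σ(Frob_v)` a.e.  (The two descents `π₀`, `π₀ ⊗ ω_E`
share their central character, which is `det σ` or `det σ · ω_E`; this bit is all that PLAN D takes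
from Tunnell's `K`-step.)  Route (M): `Q₀ = BC_K(π₀)` cuspidal (`tunnell_cuspidal_cubic_lifts`, hb),
`P_K = π(σ_K)` (dihedral, `strongArtin_of_isDihedralType`), both lift weakly to `π(σ_M)`, `M = EK`
(`eventually_map_pow_eq_of_lifts`); `ArthurClozel_fibres_quadratic` (ha) over `K` gives
`t_{Q₀} = ε^i t_{P_K}` a.e., so `∏ t_{Q₀,w} = det σ_K(Frob_w)`; at `v` with a degree-one `w ∣ v` in
`K` this is the claim, and at `v` inert in `K` (Frobenius a 3-cycle, so split in `E`) the claim is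
read off `Π_E = π(σ_E)` (`exists_place_inertiaDeg_eq_one_or_three`). -/
def SigDescentDetParity : Prop :=
  ∀ (E : Type) [Field E] [NumberField E], Module.finrank ℚ E = 2 →
    ∀ (σ : FramedArtinRep ℚ 2), IsOctahedralType σ.toMonoidHom →
      Nat.card (projectiveImage (σ.restrictField E).toMonoidHom) = 12 →
    ∀ (hQ : isCompact_glFiniteIntegralLevel 2 ℚ) (hE : isCompact_glFiniteIntegralLevel 2 E)
      (PE : CuspidalAutomorphicRepData 2 E hE), IsPiOfArtinRep (σ.restrictField E) PE.1 →
    ∀ (π₀ : CuspidalAutomorphicRepData 2 ℚ hQ), IsWeakBaseChangeLiftAE π₀.1 PE.1 →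
      ∀ᶠ v : HeightOneSpectrum (𝓞 ℚ) in Filter.cofinite, ∀ α β : Multiset ℂ,
        π₀.1.HasSatakeParamAt v α → σ.HasFrobCharpolyAt v (satakePolynomial β) → α.prod = β.prod

/-! ### D-W — weight one from parity + archimedean parameter -/

/-- **D-W (weight one of an odd-central-character `π` with parameter `{0,0}`).**  Re-typing of the
tree's `IsPiOfArtinRep.isOfWeightOne_of_hasArchParameter_pair` /
`IsPiOfArtinRep.rightTranslation_ofArch_neg_one_add_mem` (`StrongArtinCentralCharacter`), which use
`IsPiOfArtinRep σ π` ONLY through `∏ t_{π,v} = det σ(Frob_v)` a.e. (`exists_centralCharacter_eq_det`):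
the hypothesis is weakened to exactly that determinant clause (the output of D-P). (S–M) -/
def SigIsOfWeightOneOfDetParity : Prop :=
  ∀ (hcpt : isCompact_glFiniteIntegralLevel 2 ℚ) (σ : FramedArtinRep ℚ 2)
    (π : CuspidalAutomorphicRepData 2 ℚ hcpt), σ.IsOdd →
    (∀ᶠ v : HeightOneSpectrum (𝓞 ℚ) in Filter.cofinite, ∀ α β : Multiset ℂ,
        π.1.HasSatakeParamAt v α → σ.HasFrobCharpolyAt v (satakePolynomial β) → α.prod = β.prod) →
    π.1.HasArchParameter (fun _ ↦ ({0, 0} : Multiset ℂ)) → π.1.IsOfWeightOne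

/-! ### D-R — the restriction pin over `E` (Deligne–Serre rep vs `σ_E`) -/

/-- **D-R (restriction pin).**  `Π_E = π(σ_E)` exact, `π₀` a weak descent, `f` the weight-one newform
of `π₀` (Satake polynomial `=` Hecke polynomial at `p ∤ N`), `ρ_f` its Deligne–Serre representation
(`IsGaloisRepOfNewform1`).  Then `ρ_f|_{Γ_E} ≃ σ_E`.  Route (M, every tool PROVED in the tree): at a.e.
place `w` of `E` over `p`, `charpoly ρ_f(Frob_w) = charpoly (ρ_f(Frob_p)^{f(w|p)})`
(`eq_map_pow_of_hasFrobCharpolyAt_restrictField`) has roots `t_{π₀,p}^{f} = t_{Π_E,w} =` eigenvalues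
of `σ_E(Frob_w)`; Chebotarev over `E` for the pair (`chebotarev_artinRep_holds`,
`exists_monoidHom_prod_entries`) makes the characteristic polynomials agree on all of `Γ_E`, and
Brauer–Nesbitt (`brauerNesbitt_holds`; both sides semisimple: finite image, characteristic `0`)
gives the equivalence. -/
def SigRestrictionPin : Prop :=
  ∀ (E : Type) [Field E] [NumberField E], Module.finrank ℚ E = 2 →
    ∀ (σ : FramedArtinRep ℚ 2), FramedRep.IsAbsolutelyIrreducible (σ.restrictField E) →
    ∀ (hQ : isCompact_glFiniteIntegralLevel 2 ℚ) (hE : isCompact_glFiniteIntegralLevel 2 E)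
      (PE : CuspidalAutomorphicRepData 2 E hE), IsPiOfArtinRep (σ.restrictField E) PE.1 →
    ∀ (π₀ : CuspidalAutomorphicRepData 2 ℚ hQ), IsWeakBaseChangeLiftAE π₀.1 PE.1 →
    ∀ (N : ℕ) [NeZero N] (f : CuspForm (Gamma1 N) 1),
      (∀ v : HeightOneSpectrum (𝓞 ℚ), ¬ ((primesEquiv v : Nat.Primes) : ℕ) ∣ N →
          ∃ α : Multiset ℂ, π₀.1.HasSatakeParamAt v α ∧
            satakePolynomial α =
              (EllipticCurves.ModularForms.heckePolynomial f (primesEquiv v : Nat.Primes)).map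
                (algebraMap (coeffCharField f) ℂ)) →
    ∀ (ρf : FramedArtinRep ℚ 2),
      IsGaloisRepOfNewform1 f (algebraMap (coeffCharField f) ℂ) {p | p ∣ N} ρf →
      ∃ P : GL (Fin 2) ℂ, FramedRep.conj P (ρf.restrictField E) = σ.restrictField E

/-! ### D-K — after Clifford (tree: `FramedGaloisRep.exists_twist_of_conj_restrictField`, PROVED):
the twist character is `1` or `det σ` -/

/-- **D-K (the index-two character dichotomy).**  `E/ℚ` quadratic, `σ : Γ_ℚ → GL₂(ℂ)` odd with
`det σ` trivial on `Γ_E`, `χ : Γ_ℚ → ℂˣ` trivial on `Γ_E`.  Then `χ = 1` or `χ = det σ`: both are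
characters of `Γ_ℚ / res(Γ_E)`, a group of order `[E:ℚ] = 2`
(`isOpen_range_absGaloisRestrict_and_index`, `pow_finrank_mem_range_absGaloisRestrict`), and
`det σ ≠ 1` (odd).  Combined with the tree's PROVED Clifford theorem
`FramedGaloisRep.exists_twist_of_conj_restrictField` (`P ρ_f P⁻¹ = σ ⊗ χ`, `χ|_{Γ_E} = 1`, from
`ρ_f|_{Γ_E} ∼ σ|_{Γ_E}` irreducible) this pins `ρ_f` to `σ` or `σ ⊗ det σ`. (S) -/
def SigQuadraticCharacterDichotomy : Prop :=
  ∀ (E : Type) [Field E] [NumberField E], Module.finrank ℚ E = 2 →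
    ∀ (σ : FramedArtinRep ℚ 2) (χ : absoluteGaloisGroup ℚ →ₜ* ℂˣ), σ.IsOdd →
      (∀ h : absoluteGaloisGroup E, FramedRep.det σ (absGaloisRestrict ℚ E h) = 1) →
      (∀ h : absoluteGaloisGroup E, χ (absGaloisRestrict ℚ E h) = 1) →
      χ = 1 ∨ χ = FramedRep.det σ

/-! ### D-E — `det σ` is trivial on `Γ_E` (`σ̄(Γ_E) = A₄ = PSL₂(𝔽₃)`) -/

/-- **D-E.**  For `σ = Ψ ∘ ρ̄` and a field `E` over which the projective image of `σ` has order `12`,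
`det σ` is trivial on `Γ_E`: the image `H` of `ρ̄|_{Γ_E}` has `|H·Z/Z| = 12`, so `H·Z` is the unique
index-two subgroup `SL₂(𝔽₃)` of `GL₂(𝔽₃)` (the squares of `GL₂(𝔽₃)` generate `SL₂(𝔽₃)`), whence
`det ρ̄ = 1` on `Γ_E` and `det Ψ(g) = 1` for `det g = 1` (`det_lift_eq_one_or`, `redHom_det_lift`).
(S–M; finite group theory of `GL₂(𝔽₃)`.) -/
def SigDetRestrictEqOne : Prop :=
  ∀ (E : Type) [Field E] [NumberField E] (ρ : FramedGaloisRep ℚ (ZMod 3) 2),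
    Nat.card (projectiveImage ((modThreeLift ρ).restrictField E).toMonoidHom) = 12 →
    ∀ h : absoluteGaloisGroup E, FramedRep.det (modThreeLift ρ) (absGaloisRestrict ℚ E h) = 1

/-! ### D-1 — the conjugate prime `𝔭̄ = (1 - √-2)` absorbs the twist by `det` -/

/-- `1 · 1 = -2` in `𝔽₃`. -/
theorem one_mul_one_zmod_three : (1 : ZMod 3) * 1 = ((-2 : ℤ) : ZMod 3) := by decide

/-- **Reduction modulo `𝔭̄ = (1 - √-2)`**: `√-2 ↦ +1` (the conjugate of the tree's `redHom`,
`√-2 ↦ -1`). -/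
def redHomConj : ℤ√(-2) →+* ZMod 3 :=
  Zsqrtd.lift ⟨1, one_mul_one_zmod_three⟩

/-- **D-1a (`Ψ ⊗ det ≡ id (mod 𝔭̄)`).**  For every `g ∈ GL₂(𝔽₃)` the characteristic polynomial of
`det Ψ̃(g) · Ψ̃(g)` reduces modulo `𝔭̄` to that of `g`.  Reason: `Ψ̃(g)` has finite order and
`det Ψ̃(g) = d = ±1`, so complex conjugation (`= √-2 ↦ -√-2` on `ℤ[√-2]`) sends `tr Ψ̃(g) = λ₁ + λ₂`
to `λ₁⁻¹ + λ₂⁻¹ = d · tr Ψ̃(g)`; and `red ∘ conj = redHomConj`.  A `decide` over the 48 matrices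
`M2.elems` (entrywise: `redConj (det x • x) = redM x`), as for `map_redHom_charpoly_lift`. (S) -/
def SigConjCharpoly : Prop :=
  ∀ g : GL (Fin 2) (ZMod 3),
    (((lift g).det • lift g).charpoly).map redHomConj = (g : Matrix (Fin 2) (Fin 2) (ZMod 3)).charpoly

/-- Computable twin of `redHomConj` on the encoding `M2` (cf. the tree's `M2.red`): `√-2 ↦ +1`. -/
def redConjM2 (z : ℤ√(-2)) : ZMod 3 := ((z.re + z.im : ℤ) : ZMod 3)

/-- **D-1a, certified core (cheapest falsifier of the twist absorption, RUN):** for each of the `48`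
matrices `x = Ψ̃(g)`, `det x · tr x ≡ tr x` and `det x ≡ det x` under (`mod 𝔭̄`, `mod 𝔭`) respectively —
i.e. `tr` and `det` of `det Ψ̃(g) · Ψ̃(g)` reduce modulo `𝔭̄` to `tr g`, `det g`; with
`Matrix.charpoly_fin_two` this is `SigConjCharpoly`. -/
theorem d1a_core_check :
    ∀ x ∈ M2.elems, redConjM2 (M2.det x * (x.a + x.d)) = M2.red (x.a + x.d) ∧
      redConjM2 (M2.det x * M2.det x * M2.det x) = M2.red (M2.det x) := by
  decide

/-- **D-1b (a prime of `ℤ̄` above `𝔭̄`)** — verbatim twin of `exists_ideal_over_ker_redHom`. (S) -/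
def SigIdealOverConj : Prop :=
  ∃ 𝔓 : Ideal (integralClosure ℤ ℂ), 𝔓.IsMaximal ∧ 𝔓.comap embInt = RingHom.ker redHomConj

/-! ### D-T — the endgame: a weight-one newform for `σ` OR for `σ ⊗ det σ` makes `ρ̄` modular -/

/-- **D-T (endgame, twist class).**  If a weight-one newform `f` has Deligne–Serre representation
`ρ_f` (`IsGaloisRepOfNewform1`) with `P ρ_f P⁻¹ = σ` (`σ = Ψ ∘ ρ̄`) or `= σ ⊗ det σ`, then `ρ̄` is
modular.  First case: the body of the tree's
`ModPGaloisRep.isModular_of_isAbsolutelyIrreducible_of_isOdd_of_langlands_tunnell` (prime `𝔓 ∣ 𝔭`,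
`map_redHom_charpoly_lift`; conjugation does not change `IsUnramifiedAt` / `HasFrobCharpolyAt`).
Second case: the same body with `𝔓' ∣ 𝔭̄` (D-1b) and D-1a, since
`charpoly ((σ ⊗ det σ)(Frob_p)) = embHom (charpoly (det Ψ̃(g) · Ψ̃(g)))`, `g = ρ̄(Frob_p)`. (S–M) -/
def SigIsModularOfTwistClass : Prop :=
  ∀ (ρ : ModPGaloisRep ℚ (ZMod 3) 2), FramedRep.IsAbsolutelyIrreducible ρ →
    ∀ (N : ℕ) [NeZero N] (f : CuspForm (Gamma1 N) 1), IsNewform1 f →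
    ∀ (ρf : FramedArtinRep ℚ 2) (P : GL (Fin 2) ℂ),
      IsGaloisRepOfNewform1 f (algebraMap (coeffCharField f) ℂ) {p | p ∣ N} ρf →
      (FramedRep.conj P ρf = modThreeLift ρ ∨
        FramedRep.conj P ρf = FramedRep.twist (modThreeLift ρ) (FramedRep.det (modThreeLift ρ))) →
      ρ.IsModular

/-! ### The road's upstream output (Langlands' tetrahedral theorem over `E` + one cyclic descent) -/

/-- **Exact road output for the surjective cell** (what Steps 1–2 of the tree's Langlands–Tunnell
assembly deliver BEFORE Tunnell's `K`-step, plus the archimedean parameter of g17's C6a/C6b): for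
`ρ̄` odd absolutely irreducible with `σ = Ψ ∘ ρ̄` octahedral, a quadratic `E` with `σ̄(Γ_E) = A₄`,
`Π_E = π(σ_E)` cuspidal exact (`strongArtin_of_isTetrahedralType` over `E`), and a cuspidal weak
descent `π₀` on `GL₂(𝔸_ℚ)` (`cuspidal_descent_cyclic` + `isGaloisStableSatakeAE_of_isPiOfArtinRep`)
with Harish-Chandra parameter `{0,0}` (`ArthurClozel1989_strongLifting_archimedean` + C6b). -/
def SigExactRoadOutput : Prop :=
  ∀ (ρ : ModPGaloisRep ℚ (ZMod 3) 2), FramedRep.IsAbsolutelyIrreducible ρ → FramedGaloisRep.IsOdd ρ →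
    Nat.card (projectiveImage (modThreeLift ρ).toMonoidHom) = 24 →
    ∃ (E : Type) (_ : Field E) (_ : NumberField E), Module.finrank ℚ E = 2 ∧
      IsOctahedralType (modThreeLift ρ).toMonoidHom ∧
      Nat.card (projectiveImage ((modThreeLift ρ).restrictField E).toMonoidHom) = 12 ∧
      FramedRep.IsAbsolutelyIrreducible ((modThreeLift ρ).restrictField E) ∧
      ∃ (hQ : isCompact_glFiniteIntegralLevel 2 ℚ) (hE : isCompact_glFiniteIntegralLevel 2 E)
        (PE : CuspidalAutomorphicRepData 2 E hE) (π₀ : CuspidalAutomorphicRepData 2 ℚ hQ),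
        IsPiOfArtinRep ((modThreeLift ρ).restrictField E) PE.1 ∧ IsWeakBaseChangeLiftAE π₀.1 PE.1 ∧
          π₀.1.HasArchParameter (fun _ ↦ ({0, 0} : Multiset ℂ))

/-- **End-assembly of PLAN D (PROVED, pure composition):** road output + D-P + D-W + the tree's
weight-one dictionary (`hdesc`, as in g17) + Deligne–Serre (`exists_complexGaloisRep_of_weight_one`,
leaf `thm61`, already in the cone) + D-R + Clifford (tree) + D-E + D-K + D-T ⇒ the surjective (octahedral) cell of
`stub_modThree`.  No `tunnell_lemma`, no `TunnellOctahedralLocal`, no Prop. 4.2 (`hW1`). -/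
theorem isModular_surj_of_planD (hroad : SigExactRoadOutput) (hpar : SigDescentDetParity)
    (hw1 : SigIsOfWeightOneOfDetParity)
    (hdesc : ∀ (hcpt : isCompact_glFiniteIntegralLevel 2 ℚ) (π : CuspidalAutomorphicRepData 2 ℚ hcpt),
      π.1.IsOfWeightOne →
        ∃ (N : ℕ) (_ : NeZero N) (f : CuspForm (Gamma1 N) 1), IsNewform1 f ∧
          ∀ v : HeightOneSpectrum (𝓞 ℚ), ¬ ((primesEquiv v : Nat.Primes) : ℕ) ∣ N →
            ∃ α : Multiset ℂ, π.1.HasSatakeParamAt v α ∧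
              satakePolynomial α =
                (EllipticCurves.ModularForms.heckePolynomial f (primesEquiv v : Nat.Primes)).map
                  (algebraMap (coeffCharField f) ℂ))
    (hDS : ∀ (N : ℕ) [NeZero N], exists_complexGaloisRep_of_weight_one (N := N))
    (hR : SigRestrictionPin) (hE1 : SigDetRestrictEqOne) (hK : SigQuadraticCharacterDichotomy)
    (hT : SigIsModularOfTwistClass)
    (W : WeierstrassCurve ℚ) [W.IsElliptic] (ρ : ModPGaloisRep ℚ (ZMod 3) 2)
    (hρ : W.IsTorsionGaloisRep 3 ρ) (habs : FramedRep.IsAbsolutelyIrreducible ρ)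
    (h24 : Nat.card (projectiveImage (modThreeLift ρ).toMonoidHom) = 24) : ρ.IsModular := by
  haveI : Fact (Nat.Prime 3) := ⟨Nat.prime_three⟩
  haveI : NeZero ((3 : ℕ) : ℚ) := ⟨by norm_num⟩
  have hodd : FramedGaloisRep.IsOdd ρ := by
    intro φ c hc
    rw [W.det_eq_modPCyclotomicCharacter_of_isTorsionGaloisRep_holds 3 ρ hρ c]
    ext
    rw [modPCyclotomicCharacterZMod_eq_modNCyclotomicCharacter,
      modNCyclotomicCharacter_of_isComplexConjugation hc, Units.val_neg, Units.val_one]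
  set σ : FramedArtinRep ℚ 2 := modThreeLift ρ with hσ
  have hoddσ : σ.IsOdd := isOdd_modThreeLift hodd
  obtain ⟨E, _, _, hdeg, hoct, h12, habsE, hQ, hE, PE, π₀, hPE, hlift, harch⟩ := hroad ρ habs hodd h24
  have hparity := hpar E hdeg σ hoct h12 hQ hE PE hPE π₀ hlift
  have hweight : π₀.1.IsOfWeightOne := hw1 hQ σ π₀ hoddσ hparity harch
  obtain ⟨N, hN, f, hf, hsat⟩ := hdesc hQ π₀ hweight
  haveI := hN
  obtain ⟨ρf, hgal, -, -, -⟩ := hDS N hf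
  obtain ⟨P, hP⟩ := hR E hdeg σ habsE hQ hE PE hPE π₀ hlift N f hsat ρf hgal
  -- Clifford over the index-two subgroup `Γ_E` (tree, PROVED): `P' ρ_f P'⁻¹ = σ ⊗ χ`, `χ|_{Γ_E} = 1`
  haveI : Algebra.IsQuadraticExtension ℚ E := ⟨hdeg⟩
  obtain ⟨χ, P', hχ, hconj⟩ :=
    FramedGaloisRep.exists_twist_of_conj_restrictField ρf σ habsE.isIrreducible ⟨P, hP⟩
  rcases hK E hdeg σ χ hoddσ (hE1 E ρ h12) hχ with h | h
  · rw [h, FramedRep.twist_one] at hconj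
    exact hT ρ habs N f hf ρf P' hgal (Or.inl hconj)
  · rw [h] at hconj
    exact hT ρ habs N f hf ρf P' hgal (Or.inr hconj)

end Summit.ABC.ABC.Cruxes.FreyModularity.StubModThreeIdeasK2G18

end
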